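import Literature.Topology.FourManifolds.TrisectionsTubeFrame
import Literature.Topology.FourManifolds.TrisectionsSectorThreeFunction
import Literature.Topology.FourManifolds.TrisectionsSectorWeight
import HarnessLib

/-!
# A boundary-adapted function on the middle sector `X₂` ("`X₂ ≅ ♮ᵏ S¹ × B³`", Gay–Kirby 2016,
# Lemma 14), I: the function, its corner form and its values on the faces

Topic `Literature/Topology/FourManifolds`; infrastructure for the fact seat
`provefact-Literature.Topology.FourManifolds.exists_isBalancedGKTrisection` (Gay–Kirby 2016,
Thm. 4 via §4, Lemma 14).  Everything in this file is **proved**; the definitions are explicit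
functions; no named facts are introduced.

The middle sector `X₂ = closure {Hit, M < 0} ∪ sheets` of a `TriData` (Gay–Kirby's
"`[0, ε] × H₁₂ ∪ 2`-handles") has, in its straightened structure `TriData.cornerSliceAtlas₂`,
the corner locus `F` and the two faces `X₂ ∩ X₁ = {F₁ = 0} = {V = 0}` (the bevel face, `V` the
face function `BevelData.faceV` of `X₁`: on `X₂`, `r ≤ 0` in the band and `F₁ = -V`) and
`H₂₃ = {M̃ = 0}` (`M̃ = TriData.Mt`, the interface function extended by `f - c` to the points
which do not hit the level).  As for `X₁` and `X₃` (`TrisectionsSectorOne/ThreeFunction.lean`)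
clause (ii) of `IsGKTrisection` needs a function on `X` of corner form near `F`, `= 1` on
`∂X₂`, `< 1` and Morse inside.  Following the product ansatz of the Morse-theoretic
construction (the tree's `HandleBoxes.psiTwo` of `TrisectionsSectorTwoFunction.lean` for the
linear sectors), the function is

  `ψ₂ = 1 - C · Ψ₂`,  `Ψ₂ = (-V) · (-M̃) · W · R`,

with the weight `W = HandleBoxes.weight` (`w(φ̄)`, `φ̄` the lifted Heegaard function, replaced by
`w(k_g 𝒯̂_j)` on the chart zones of the `2`-handles) and the radial correction
`R = HandleBoxes.radial R₀` of `TrisectionsSectorWeight.lean`, over the tube frame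
`TriData.TubeFrame` of `TrisectionsTubeFrame.lean`.  This file fixes the parameters
(`TubeFrame.MidParams`), defines `Ψ₂`, `ψ₂`, and proves the zeroth-order facts:

* on the bi-collar box `Ψ₂ = u₂ v₂ · w(b)` (`u₂ = s - κ r`, `v₂ = -r`, the wedge coordinates of
  `TriData.frame₂`): the corner form (`MidParams.PsiTwo_of_mem_box`);
* `Ψ₂ = 0` on `∂X₂` (`MidParams.PsiTwo_eq_zero_of_boundary`), `Ψ₂ > 0` at the interior points
  (`MidParams.PsiTwo_pos_of_interior`), hence `ψ₂ = 1` on `∂X₂` and `ψ₂ < 1` inside;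
* **the plateau of the handle columns**: on the chart zone `{A_j < a_R}` every point of `X₂`
  has `M̃ = f - c` (`MidParams.Mt_eq_sub_of_mem_zone`: there `G ≤ -m₀` and
  `m₀ ≥ η₂ + ν² + ε + δ_U`, so the rounding is on its plateau), whence `Ψ₂` reads
  `s (T₀ - s) W R`, `T₀ = c - a`, near the `2`-handles.

## References

* D. Gay, R. Kirby, *Trisecting 4-manifolds*, Geom. Topol. 20 (2016), §4, Lemma 14. [GayKirby2016]
* J. Milnor, *Morse theory* (1963), Thm. 3.1 and §3. [Milnor1963]
* J. Milnor, *Lectures on the h-cobordism theorem* (1965), Def. 3.1, Thm. 3.12. [MilnorHCobordism1965]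
-/

open scoped Manifold ContDiff Topology
open Set Function Filter

noncomputable section

universe u

namespace Literature.Topology.FourManifolds

open Flow

variable {X : Type u} [TopologicalSpace X] [T2Space X] [CompactSpace X]
  [ChartedSpace (EuclideanSpace ℝ (Fin 4)) X] [IsManifold (𝓡 4) ∞ X]

namespace BiCollar

namespace TriData

namespace TubeFrame

variable {B : BiCollar X} {T : B.TriData} {ι : Type} [Fintype ι] (𝔉 : T.TubeFrame ι)

/-! ### Parameters -/

/-- **Parameters of the adapted function on `X₂`** over a tube frame: the chart-zone radius
`a_R` (between `A* = (η₂ - ν²)/2` and `η₂/2`), the weight profile `w` (positive, non-increasing,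
constant on `[b - δ_w, ∞)` with `ε_w ≤ δ_w`, `δ_w` small), the cap `ρ` of `1/A` (`= 1/A` on
`[a_R/2, ∞)`), the radial profile `R₀` (`= 1` on `[a_R', ∞)`), the constant `C`, a slope bound of
`χ₁` with the smallness of the bevel slope, the **plateau inequality**
`η₂ + ν² + ε + δ_U ≤ m₀`, the normalisation `g₀ = 0`, and the explicit form of `g` on the level
near the tubes (`g = k_g 𝒯 ∘ coord_j` where `𝒯 < 1 + 2δ_g`). [cite: GayKirby2016, §4, Lemma 14] -/
structure MidParams where
  /-- The chart-zone radius. -/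
  aR : ℝ
  /-- The radius beyond which the radial correction is `1`. -/
  aR' : ℝ
  /-- The weight profile. -/
  w : ℝ → ℝ
  /-- The window of constancy of the weight below `b`. -/
  δw : ℝ
  /-- The cap of `1/A`. -/
  ρ : ℝ → ℝ
  /-- The radial profile. -/
  R₀ : ℝ → ℝ
  /-- The constant of `ψ₂ = 1 - C Ψ₂`. -/
  C : ℝ
  /-- A bound for `|χ₁'|`. -/
  L : ℝ
  /-- The saturation window of the Heegaard function's explicit form. -/
  δg : ℝ
  aR_pos : 0 < aR
  /-- `A* < a_R'`. -/
  lt_aR' : (𝔉.η₂ - 𝔉.ν ^ 2) / 2 < aR'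
  aR'_lt : aR' < aR
  /-- `2 a_R ≤ η₂`. -/
  two_aR_le : 2 * aR ≤ 𝔉.η₂
  /-- The unit band and the column radius fit below the critical level: `δ_U + 2a_R ≤ η₂`. -/
  band_aR : B.U.δ + 2 * aR ≤ 𝔉.η₂
  /-- The unit band and the rounding width are small against the height of `X₂`:
  `4δ_U + 2ε ≤ c - a` (flow monotonicity of `Ψ₂` on the band). -/
  band4 : B.a + 4 * B.U.δ + 2 * T.ε ≤ T.c
  /-- The handle columns `{A_j < 2a_R, f < c}` lie in the thin tubes: `2a_R (ν² + 2a_R) ≤ P₀`. -/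
  col_P : 2 * aR * (𝔉.ν ^ 2 + 2 * aR) ≤ 𝔉.P₀
  w_contDiff : ContDiff ℝ ∞ w
  w_pos : ∀ t, 0 < w t
  w_deriv_nonpos : ∀ t, deriv w t ≤ 0
  w_deriv_neg : ∀ t, t < B.b - δw → deriv w t < 0
  w_const : ∀ t, B.b - δw ≤ t → w t = w B.b
  εw_le_δw : T.D.εw ≤ δw
  /-- `δ_w` is small: the weight is strictly decreasing wherever the rounding is on its plateau at
  the fibre-critical heights. -/
  δw_lt : δw < (T.c - B.a) / 2 + T.ε
  /-- `δ_w < m₀`: the weight is strictly decreasing at the values of `g` on the thin tubes. -/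
  δw_lt_m₀ : δw < 𝔉.m₀
  /-- The values of `k_g 𝒯̂` on the handle columns stay below `b - m₀`. -/
  tube_top : 𝔉.kg * (1 + 𝔉.κT / 𝔉.η₂ * 𝔉.P₀) ≤ B.b - 𝔉.m₀
  ρ_contDiff : ContDiff ℝ ∞ ρ
  ρ_nonneg : ∀ A, 0 ≤ ρ A
  ρ_deriv_nonpos : ∀ A, deriv ρ A ≤ 0
  ρ_eq_inv : ∀ A, aR / 2 ≤ A → ρ A = A⁻¹
  R₀_contDiff : ContDiff ℝ ∞ R₀
  R₀_pos : ∀ A, 0 < R₀ A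
  R₀_deriv_nonpos : ∀ A, deriv R₀ A ≤ 0
  R₀_eq_one : ∀ A, aR' ≤ A → R₀ A = 1
  /-- **The design inequality** of the handle columns (`TrisectionsChartZoneCore.lean`) for
  `𝒜(a) = (η₂ - a)(ν² + a) R₀(a)`, at every radius² `a < 2a_R` and every weight argument. -/
  design : ∀ a t, 0 ≤ a → a < 2 * aR →
    ChartZone.DesignIneq (fun a => (𝔉.η₂ - a) * (𝔉.ν ^ 2 + a) * R₀ a) w ρ 𝔉.kg 𝔉.εT a t
  /-- **The radial inequality** of the handle columns (`TrisectionsMidSectorColumnModel.lean`). -/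
  radial : ∀ a t, 0 ≤ a → a < 2 * aR →
    𝔉.εT * a * (ρ a + a * deriv ρ a) * |deriv w t| * 𝔉.kg * R₀ a ≤
      a * w t * (-deriv R₀ a) + a ^ 2 * (𝔉.κT / 𝔉.η₂) * |deriv w t| * 𝔉.kg * R₀ a
  C_pos : 0 < C
  abs_deriv_le : ∀ s, |deriv T.D.χ₁ s| ≤ L
  hκ : T.D.κ * L * T.D.χ₂.rOut ≤ 1 / 4
  /-- The plateau inequality. -/
  plateau : 𝔉.η₂ + 𝔉.ν ^ 2 + T.ε + B.U.δ ≤ 𝔉.m₀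
  g₀_eq : 𝔉.g₀ = 0
  δg_pos : 0 < δg
  /-- The explicit form of `g` extends over the shell of the zones: `(κ_T/η₂)(2a_R)(2η₂) < 2δ_g`. -/
  hκδ : 𝔉.κT / 𝔉.η₂ * (2 * aR) * (2 * 𝔉.η₂) < 2 * δg
  /-- `g = k_g 𝒯 ∘ coord_j` on the part of the level in `source_j` where `𝒯 < 1 + 2δ_g`. -/
  g_form : ∀ j (y : B.Y), RegularLevel.incl B.hf y ∈ (𝔉.boxes.box j).chart.source →
    TubeModel.tube 𝔉.εT 𝔉.κT 𝔉.η₂ ((𝔉.boxes.box j).coord (RegularLevel.incl B.hf y)) < 1 + 2 * δg →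
    B.g y = 𝔉.kg * TubeModel.tube 𝔉.εT 𝔉.κT 𝔉.η₂ ((𝔉.boxes.box j).coord (RegularLevel.incl B.hf y))

namespace MidParams

variable {𝔉} (𝔔 : 𝔉.MidParams)

omit [T2Space X] [CompactSpace X] in
/-- `a_R ≤ η₂`. [folklore] -/
theorem aR_le : 𝔔.aR ≤ 𝔉.η₂ := by linarith [𝔔.two_aR_le, 𝔔.aR_pos]

omit [T2Space X] [CompactSpace X] in
include 𝔔 in
/-- The side condition `hc2 : a + δ_U + 2ε ≤ c` of the sector atlases. [folklore] -/
theorem hc2 : B.a + B.U.δ + 2 * T.ε ≤ T.c := by linarith [𝔔.band4, B.U.δ_pos]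

omit [T2Space X] [CompactSpace X] in
/-- `0 < a_R'`. [folklore] -/
theorem aR'_pos : 0 < 𝔔.aR' := by
  have h := 𝔔.lt_aR'
  have : 0 ≤ (𝔉.η₂ - 𝔉.ν ^ 2) / 2 := by linarith [𝔉.two_nu_sq_le, sq_nonneg 𝔉.ν]
  linarith

/-! ### The weight, the radial correction and the function -/

/-- **The weight** `W` of the tube frame (seat of `TrisectionsSectorWeight.lean`'s `HandleBoxes.weight`
for the frame's boxes, the field `ζ` and the Heegaard function `g`). [cite: GayKirby2016, §4, Lemma 14] -/
def W : X → ℝ := 𝔉.boxes.weight 𝔉.hζ B.hf B.g 𝔔.w 𝔔.ρ 𝔉.kg 𝔉.εT 𝔉.κT 𝔔.aR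

/-- **The radial correction** `R`. [cite: GayKirby2016, §4, Lemma 14] -/
def Rad : X → ℝ := 𝔉.boxes.radial 𝔔.R₀

/-- **`Ψ₂ = (-V) · (-M̃) · W · R`.** [cite: GayKirby2016, §4, Lemma 14] -/
def PsiTwo (x : X) : ℝ := (-T.D.faceV x) * (-T.Mt x) * 𝔔.W x * 𝔔.Rad x

/-- **The adapted function `ψ₂ = 1 - C Ψ₂` on `X₂`.** [cite: GayKirby2016, §4, Lemma 14] -/
def psiTwo (x : X) : ℝ := 1 - 𝔔.C * 𝔔.PsiTwo x

/-- `W > 0`. [folklore] -/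
theorem W_pos (x : X) : 0 < 𝔔.W x := by
  unfold W
  by_cases h : ∃ j, x ∈ 𝔉.boxes.zone 𝔔.aR j
  · obtain ⟨j, hj⟩ := h
    rw [𝔉.boxes.weight_of_mem_zone hj]; exact 𝔔.w_pos _
  · push Not at h
    rw [𝔉.boxes.weight_of_forall_not_mem h]; exact 𝔔.w_pos _

omit [T2Space X] [CompactSpace X] in
/-- `R > 0`. [folklore] -/
theorem Rad_pos (x : X) : 0 < 𝔔.Rad x := by
  unfold Rad
  by_cases h : ∃ j, x ∈ (𝔉.boxes.box j).chart.source
  · obtain ⟨j, hj⟩ := h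
    rw [𝔉.boxes.radial_of_mem_source hj]; exact 𝔔.R₀_pos _
  · push Not at h
    rw [𝔉.boxes.radial_of_forall_not_mem h]; exact one_pos

/-! ### The chart domains miss the bi-collar box and the band near `F` -/

omit [T2Space X] [CompactSpace X] in
/-- A point of `source_j` with `A_j < a_R` lies in the thin tube `P_j < P₀` as soon as `f ≤ c`. [folklore] -/
theorem P_lt_of_A_lt {j : ι} {x : X} (hx : x ∈ (𝔉.boxes.box j).chart.source) (hA : 𝔉.boxes.A j x < 𝔔.aR)
    (hfc : B.f x ≤ T.c) : 𝔉.boxes.P j x < 𝔉.P₀ := by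
  have hA0 := 𝔉.boxes.A_nonneg j x
  have hB0 := 𝔉.boxes.B_nonneg j x
  have hB : 𝔉.boxes.B j x ≤ 𝔉.ν ^ 2 + 𝔉.boxes.A j x := by
    have h := 𝔉.boxes.apply_eq hx
    rw [𝔉.c_eq] at hfc
    linarith
  rw [HandleBoxes.P_def]
  calc 𝔉.boxes.A j x * 𝔉.boxes.B j x ≤ 𝔉.boxes.A j x * (𝔉.ν ^ 2 + 𝔉.boxes.A j x) :=
        mul_le_mul_of_nonneg_left hB hA0
    _ < 𝔔.aR * (𝔉.ν ^ 2 + 𝔔.aR) := by nlinarith [𝔉.ν_pos, 𝔔.aR_pos]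
    _ ≤ 2 * 𝔔.aR * (𝔉.ν ^ 2 + 2 * 𝔔.aR) := by nlinarith [𝔉.ν_pos, 𝔔.aR_pos]
    _ ≤ 𝔉.P₀ := 𝔔.col_P

/-- **On the chart zone, `G ≤ -m₀` at hitting points of `X₂`-height** (`a - η₂ < f ≤ c`). [cite: GayKirby2016, §4, Lemma 14] -/
theorem gFun_le_of_mem_zone {j : ι} {x : X} (hz : x ∈ 𝔉.boxes.zone 𝔔.aR j) (hf₁ : B.a - 𝔉.η₂ < B.f x)
    (hfc : B.f x ≤ T.c) (hh : B.Hit x) : B.gFun x ≤ -𝔉.m₀ :=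
  𝔉.gFun_le_of_P_lt hz.1 (𝔔.P_lt_of_A_lt hz.1 hz.2 hfc) hf₁ (hfc.trans_lt 𝔉.c_lt) hh

/-- **The plateau of the handle columns**: at a hitting point of the chart zone with
`a - δ_U < f ≤ c`, the rounding is on its plateau and `M = f - c`. [cite: GayKirby2016, §4, Lemma 14] -/
theorem M_eq_sub_of_mem_zone {j : ι} {x : X} (hz : x ∈ 𝔉.boxes.zone 𝔔.aR j) (hf₁ : B.a - B.U.δ < B.f x)
    (hfc : B.f x ≤ T.c) (hh : B.Hit x) : T.M x = B.f x - T.c := by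
  have hG := 𝔔.gFun_le_of_mem_zone hz (by linarith [𝔉.band_le]) hfc hh
  apply T.M_eq_sub_of_le_w
  show T.ε ≤ B.f x - T.c - B.gFun x
  have := 𝔔.plateau
  rw [𝔉.c_eq] at *
  linarith [𝔉.ν_pos]

/-- **`M̃ = f - c` at every point of `X₂` in a chart zone.** [cite: GayKirby2016, §4, Lemma 14] -/
theorem Mt_eq_sub_of_mem_zone {j : ι} {x : X} (hz : x ∈ 𝔉.boxes.zone 𝔔.aR j) (hf₁ : B.a - B.U.δ < B.f x)
    (hfc : B.f x ≤ T.c) : T.Mt x = B.f x - T.c := by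
  by_cases hh : B.Hit x
  · rw [T.Mt_of_hit hh, 𝔔.M_eq_sub_of_mem_zone hz hf₁ hfc hh]
  · exact T.Mt_of_not_hit hh

/-- **The bi-collar box misses the chart zones** (box points hit, with `|G| = |r| < ε_w < m₀`). [folklore] -/
theorem not_mem_zone_of_mem_box {x : X} (hx : x ∈ B.box T.D.εw) (j : ι) : x ∉ 𝔉.boxes.zone 𝔔.aR j := fun hz => by
  have hh : B.Hit x := T.hit_of_mem_box hx
  have hs : |B.sFun x| < T.D.εw := hx.1
  have hsdef : B.sFun x = B.f x - B.a := rfl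
  have hf₁ : B.a - 𝔉.η₂ < B.f x := by
    have := (abs_lt.1 hs).1; have := 𝔉.band_le; have := T.D.εw_le_δU; linarith
  have hfc : B.f x ≤ T.c := by
    have := (abs_lt.1 hs).2; have := T.ε_le; have := T.ε_pos; have := T.D.εw_pos; linarith
  have hG := 𝔔.gFun_le_of_mem_zone hz hf₁ hfc hh
  have hr : |B.rFun x| < T.D.εw := hx.2
  rw [T.gFun_eq_rFun_of_mem_box hx] at hG
  have := 𝔔.plateau; have := 𝔉.η₂_pos; have := sq_nonneg 𝔉.ν; have := T.ε_pos; have := T.D.εw_le_δU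
  linarith [(abs_lt.1 hr).1]

/-! ### The corner form on the box -/

/-- **On the box, `W = w(b)`** (`φ̄ = g ∘ λ = b + r` with `|r| < ε_w ≤ δ_w`). [cite: GayKirby2016, §4, Lemma 14] -/
theorem W_of_mem_box {x : X} (hx : x ∈ B.box T.D.εw) : 𝔔.W x = 𝔔.w B.b := by
  unfold W
  rw [𝔉.boxes.weight_of_forall_not_mem (𝔔.not_mem_zone_of_mem_box hx)]
  have hh : B.Hit x := T.hit_of_mem_box hx
  have hlift : flowLift 𝔉.hζ B.hf B.g x = B.gFun x + B.b := by
    rw [flowLift_of_hits B.g ((𝔉.hit_iff x).1 hh), BiCollar.gFun]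
    have h := 𝔉.incl_lamLift_eq hh
    have : (⟨levelProj 𝔉.hζ B.f B.a x, apply_levelProj 𝔉.hζ ((𝔉.hit_iff x).1 hh)⟩ : B.Y) = B.lamLift x :=
      Subtype.ext h.symm
    rw [this]; ring
  rw [hlift, T.gFun_eq_rFun_of_mem_box hx]
  apply 𝔔.w_const
  have hr : |B.rFun x| < T.D.εw := hx.2
  linarith [(abs_lt.1 hr).1, 𝔔.εw_le_δw]

/-- The box lies below every chart zone radius: a point of `source_j` in the box has
`A_j > a_R` — indeed `A_j > η₂ - ε_w ≥ η₂ - δ_U ≥ a_R`. [folklore] -/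
theorem aR_lt_A_of_mem_box {j : ι} {x : X} (hx : x ∈ B.box T.D.εw) (hsrc : x ∈ (𝔉.boxes.box j).chart.source) :
    𝔔.aR < 𝔉.boxes.A j x := by
  have h := 𝔉.boxes.apply_eq hsrc
  have hs : |B.sFun x| < T.D.εw := hx.1
  have hsdef : B.sFun x = B.f x - B.a := rfl
  have hB0 := 𝔉.boxes.B_nonneg j x
  have := 𝔔.band_aR; have := T.D.εw_le_δU; have := 𝔔.aR_pos
  have := (abs_lt.1 hs).2
  linarith

/-- **On the box, `R = 1`.** [folklore] -/
theorem Rad_of_mem_box {x : X} (hx : x ∈ B.box T.D.εw) : 𝔔.Rad x = 1 :=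
  𝔉.boxes.radial_eq_one_of_le 𝔔.R₀_eq_one fun _ hj => (𝔔.aR'_lt.trans (𝔔.aR_lt_A_of_mem_box hx hj)).le

/-- **On the box, `-V = u₂ = s - κ r`** (wedge coordinate of `frame₂`). [cite: GayKirby2016, Def. 1 and Fig. 1] -/
theorem _root_.Literature.Topology.FourManifolds.BiCollar.TriData.neg_faceV_of_mem_box (T : B.TriData) {x : X}
    (hx : x ∈ B.box T.D.εw) : -T.D.faceV x = B.uFun T.frame₂ x := by
  rw [T.D.faceV_eq_vFun_of_mem_box hx, T.uFun_frame₂]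
  show -(-1 * B.sFun x + T.D.κ * B.rFun x) = B.sFun x - T.D.κ * B.rFun x
  ring

/-- On the box, `-M̃ = v₂ = -r`. [cite: GayKirby2016, Def. 1 and Fig. 1] -/
theorem _root_.Literature.Topology.FourManifolds.BiCollar.TriData.neg_Mt_of_mem_box (T : B.TriData) {x : X}
    (hx : x ∈ B.box T.D.εw) : -T.Mt x = B.vFun T.frame₂ x := by
  rw [T.Mt_of_mem_box hx, T.vFun_frame₃, T.vFun_frame₂]

/-- **On the box, `Ψ₂` is the corner form `w(b) · u₂ v₂`.** [cite: GayKirby2016, Def. 1 and Fig. 1] -/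
theorem PsiTwo_of_mem_box {x : X} (hx : x ∈ B.box T.D.εw) :
    𝔔.PsiTwo x = 𝔔.w B.b * (B.uFun T.frame₂ x * B.vFun T.frame₂ x) := by
  rw [PsiTwo, T.neg_faceV_of_mem_box hx, T.neg_Mt_of_mem_box hx, 𝔔.W_of_mem_box hx, 𝔔.Rad_of_mem_box hx]
  ring

/-! ### Values on the faces and inside -/

section Values

variable (hc2 : B.a + B.U.δ + 2 * T.ε ≤ T.c)

/-- **On `X₂`, `V = -F₁`** (`r ≤ 0` on the support of the bevel). [cite: GayKirby2016, §4, Lemma 14] -/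
theorem _root_.Literature.Topology.FourManifolds.BiCollar.TriData.faceV_eq_neg_F₁_of_mem_X₂ (T : B.TriData)
    (hc2 : B.a + B.U.δ + 2 * T.ε ≤ T.c) {x : X} (hx2 : x ∈ T.X₂) : T.D.faceV x = -T.D.F₁ x := by
  by_cases hband : |B.sFun x| < T.D.χ₁.rOut
  · -- in the support of the bevel: `r ≤ 0` on `X₂`
    have hxb : x ∈ B.U.band := B.mem_band_U (hband.trans T.D.rOut₁_lt)
    have hh : B.Hit x := B.hit_of_mem_band hxb
    have hr : B.rFun x ≤ 0 := by
      have hM := T.M_nonpos_of_mem_X₂ hh hx2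
      rcases T.M_eq_rFun_or_of_mem_band hc2 hxb with h | h
      · rw [← h]; exact hM
      · exact (h.2.trans (by linarith [T.ε_pos])).le
    rw [T.D.F₁_eq_neg_faceV hr]; ring
  · push Not at hband
    rw [T.D.faceV_eq_neg_sFun_of_le hband]
    have hθ := T.D.θ_eq_zero_of_le hband
    have : T.D.F₁ x = B.sFun x + T.D.κ * T.D.θ x := rfl
    rw [this, hθ]; ring

/-- **On `X₂`, `M̃ ≤ 0`.** [cite: GayKirby2016, §4, Lemma 14] -/
theorem _root_.Literature.Topology.FourManifolds.BiCollar.TriData.Mt_nonpos_of_mem_X₂ (T : B.TriData) {x : X}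
    (hx2 : x ∈ T.X₂) : T.Mt x ≤ 0 := by
  by_cases hh : B.Hit x
  · rw [T.Mt_of_hit hh]; exact T.M_nonpos_of_mem_X₂ hh hx2
  · rw [T.Mt_of_not_hit hh]; linarith [T.f_le_c_of_mem_X₂ hx2]

include hc2 in
/-- **`Ψ₂ = 0` on `∂X₂`** (the surface, the bevel face `F₁ = 0`, the interface `M̃ = 0`). [cite: GayKirby2016, §4, Lemma 14] -/
theorem PsiTwo_eq_zero_of_boundary {x : X} (hx2 : x ∈ T.X₂) (h : x ∈ B.surface ∨ T.D.F₁ x = 0 ∨ T.Mt x = 0) :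
    𝔔.PsiTwo x = 0 := by
  rcases h with hs | h0 | hM
  · rw [PsiTwo, T.faceV_eq_neg_F₁_of_mem_X₂ hc2 hx2, T.D.F₁_eq_zero_of_mem_surface hs]; ring
  · rw [PsiTwo, T.faceV_eq_neg_F₁_of_mem_X₂ hc2 hx2, h0]; ring
  · rw [PsiTwo, hM]; ring

include hc2 in
/-- **`Ψ₂ > 0` at the interior points of `X₂`** (`-V > 0`, `-M̃ > 0`, `W > 0`, `R > 0`). [cite: GayKirby2016, §4, Lemma 14] -/
theorem PsiTwo_pos_of_interior {x : X} (hx2 : x ∈ T.X₂) (h0 : T.D.F₁ x ≠ 0) (hM : T.Mt x ≠ 0) : 0 < 𝔔.PsiTwo x := by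
  have h1 : 0 < -T.D.faceV x := by
    rw [T.faceV_eq_neg_F₁_of_mem_X₂ hc2 hx2, neg_neg]
    exact lt_of_le_of_ne (T.F₁_nonneg_of_mem_X₂ hx2) (Ne.symm h0)
  have h2 : 0 < -T.Mt x := by
    have := T.Mt_nonpos_of_mem_X₂ hx2
    rcases this.lt_or_eq with h | h
    · linarith
    · exact absurd h hM
  unfold PsiTwo
  exact mul_pos (mul_pos (mul_pos h1 h2) (𝔔.W_pos x)) (𝔔.Rad_pos x)

include hc2 in
/-- **`ψ₂ = 1` on `∂X₂` and `ψ₂ < 1` inside.** [cite: GayKirby2016, §4, Lemma 14] -/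
theorem psiTwo_eq_one_of_boundary {x : X} (hx2 : x ∈ T.X₂) (h : x ∈ B.surface ∨ T.D.F₁ x = 0 ∨ T.Mt x = 0) :
    𝔔.psiTwo x = 1 := by
  rw [psiTwo, 𝔔.PsiTwo_eq_zero_of_boundary hc2 hx2 h]; ring

include hc2 in
/-- `ψ₂ < 1` inside. [cite: GayKirby2016, §4, Lemma 14] -/
theorem psiTwo_lt_one_of_interior {x : X} (hx2 : x ∈ T.X₂) (h0 : T.D.F₁ x ≠ 0) (hM : T.Mt x ≠ 0) :
    𝔔.psiTwo x < 1 := by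
  have := 𝔔.PsiTwo_pos_of_interior hc2 hx2 h0 hM
  have := 𝔔.C_pos
  rw [psiTwo]; nlinarith

end Values

end MidParams

end TubeFrame

end TriData

end BiCollar

end Literature.Topology.FourManifolds

end
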